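import Summits.Ventures.Crystal3D.Theorems.StickyWulffConstantPolycrystalWulffBoundRungSingleAxisHybrid

/-!
# `PolycrystalWulffBound`: preliminaries for the GENERAL RELABELLING rung (multi-axis textures)

Route `StickyWulffConstant` of the venture `Summits/Ventures/Crystal3D`, crux `PolycrystalWulffBound`
(item `stmt-Ventures-19482`), second prover lane (poly-p2, gen 11).  Three bricks for the relabelling
rung `rung_relabel_texture` (next file), which handles textures of ARBITRARY lattice content (several
twin axes, generic grains) by relabelling every grain with a frame of ONE single-axis colony:
* `freeEnergy_bodyChange_le_add_family` — the sharp body change with a PER-GRAIN gap body `D_f`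
  (`Fr(K') ≤ Fr(K) + Σ_{f ∈ T} c_f · Fr_{D_f}(f)` under `h_{K'_f} ≤ h_{K_f} + c_f·h_{D_f}`); a secondary
  twin class about an axis `m_f ≠ m₀` is relabelled at cost `(1/√6)·Fr_{Dsc m_f}(f)`;
* `sin_le_supportFn_cruxDisc'`, `sinSum_le_iota_of_polytopeCalculus'` — the wall-budget lemma for the
  texture's OWN wall data `m f g` with `‖m f g‖ = 1 ∨ m f g = 0` (the crux's `Tex` gives exactly these
  two cases for grains of different lattices: co-axial twin walls `Ax (m f g)`, charge `≥ ½`, and generic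
  walls `m f g = 0`, charge `≥ 1`, body `Dsc 0 =` unit ball);
* `supportFn_cruxWulffBody_le_of_Ax` — the crux-vocabulary discharge of the gap hypothesis: for frames
  `X, Y` with `Ax m X Y` and three admissible (bond, `⟨112⟩`) pairs of `X` about `m`,
  `h_{W(X)} ≤ h_{W(Y)} + (1/√6)·h_{Dsc m}` (`supportFn_le_twin_disc` + `cruxWulffBody_eq_or_eq_reflection_image`).
WHAT THIS IS NOT: the rung itself; the crux is not claimed.
-/

noncomputable section

namespace Summit.Ventures.Crystal3D.Theorems

open MeasureTheory Set
open scoped BigOperators InnerProductSpace ENNReal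
open Summit.Ventures.Crystal3D.Cruxes.TextureLiminf.TexShadow
open Literature.MathematicalPhysics.StatisticalMechanics (fccStacking barlowStacking IsHaggSeq)

/-! ### Body change with a per-grain gap body -/

/-- **Sharp body change, per-grain gap bodies.**  For pairwise disjoint polyhedral grains of finite
volume, origin-symmetric compact convex bodies `K_f`, `K'_f` with `K'_f = K_f` off `T`, and symmetric
compact convex gap bodies `D_f ∋ 0` with `h_{K'_f} ≤ h_{K_f} + c_f·h_{D_f}` on `T`:
`Fr(K') ≤ Fr(K) + Σ_{f ∈ T} c_f·Fr_{D_f}(f)`. -/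
theorem freeEnergy_bodyChange_le_add_family {n : ℕ} (G : Fin n → Set E3)
    (hPoly : ∀ f, ∃ (k : ℕ) (H : Fin k → Finset (E3 × ℝ)), G f = ⋃ i, polytope (H i))
    (hvol : ∀ f, volume (G f) < ⊤) (hdisjG : ∀ f g, f ≠ g → Disjoint (G f) (G g))
    (Kf : Fin n → Set E3) (hKc : ∀ f, IsCompact (Kf f)) (hKv : ∀ f, Convex ℝ (Kf f))
    (hK0 : ∀ f, (0 : E3) ∈ Kf f) (hKs : ∀ f, -Kf f = Kf f)
    (Kf' : Fin n → Set E3) (hKc' : ∀ f, IsCompact (Kf' f)) (hKv' : ∀ f, Convex ℝ (Kf' f))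
    (hK0' : ∀ f, (0 : E3) ∈ Kf' f) (hKs' : ∀ f, -Kf' f = Kf' f)
    (D : Fin n → Set E3) (hDc : ∀ f, IsCompact (D f)) (hDv : ∀ f, Convex ℝ (D f))
    (hD0 : ∀ f, (0 : E3) ∈ D f) (hDs : ∀ f, -D f = D f)
    (c : Fin n → ℝ) (T : Finset (Fin n)) (hT : ∀ f, f ∉ T → Kf' f = Kf f)
    (hgap : ∀ f ∈ T, ∀ ν : E3, supportFn (Kf' f) ν ≤ supportFn (Kf f) ν + c f * supportFn (D f) ν) :
    (∑ f, (per (Kf' f) (G f) - ∑ g, (if f = g then 0 else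
        (per (Kf' f) (G f) + per (Kf' f) (G g) - per (Kf' f) (G f ∪ G g)) / 2))) ≤
      (∑ f, (per (Kf f) (G f) - ∑ g, (if f = g then 0 else
        (per (Kf f) (G f) + per (Kf f) (G g) - per (Kf f) (G f ∪ G g)) / 2))) +
      ∑ f ∈ T, c f * (per (D f) (G f) - ∑ g, (if f = g then 0 else
        (per (D f) (G f) + per (D f) (G g) - per (D f) (G f ∪ G g)) / 2)) := by
  classical
  obtain ⟨k, H, ν, S, SX, -, hext, -⟩ := exists_exterior_crossSums G hPoly hvol hdisjG
  set X : Set E3 → Fin k → Fin k → ℝ := fun K a b =>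
    (if a < b then (supportFn K (ν a b) + supportFn K (-ν a b)) *
        facetArea (closure (polytope (H a)) ∩ closure (polytope (H b))) (ν a b)
      else (supportFn K (ν b a) + supportFn K (-ν b a)) *
        facetArea (closure (polytope (H b)) ∩ closure (polytope (H a))) (ν b a)) with hX
  have hf : ∀ (K : Set E3), IsCompact K → Convex ℝ K → (0 : E3) ∈ K → -K = K → ∀ f,
      per K (G f) - ∑ g, (if f = g then 0 else
        (per K (G f) + per K (G g) - per K (G f ∪ G g)) / 2) =
      (∑ a ∈ S f, ∑ b ∈ SX, X K a b) / 2 := by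
    intro K hK hKv0 hK00 hKs0 f
    have h : 2 * per K (G f) = (∑ g ∈ Finset.univ.erase f,
        (per K (G f) + per K (G g) - per K (G f ∪ G g))) +
        ∑ a ∈ S f, ∑ b ∈ SX, X K a b := hext K hK hKv0 hK00 hKs0 f
    rw [sum_ite_eq_sum_erase_div_two]
    linarith
  set FrK : Set E3 → Fin n → ℝ := fun K f => per K (G f) - ∑ g, (if f = g then 0 else
      (per K (G f) + per K (G g) - per K (G f ∪ G g)) / 2) with hFrK
  have hgrain : ∀ f, FrK (Kf' f) f ≤ FrK (Kf f) f + (if f ∈ T then c f * FrK (D f) f else 0) := by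
    intro f
    by_cases hfT : f ∈ T
    · rw [if_pos hfT]
      have hsum := crossSum_le_add_of_supportFn_le (hgap f hfT) H ν (S f) SX
      simp only [hFrK]
      rw [hf _ (hKc' f) (hKv' f) (hK0' f) (hKs' f) f, hf _ (hKc f) (hKv f) (hK0 f) (hKs f) f,
        hf _ (hDc f) (hDv f) (hD0 f) (hDs f) f]
      simp only [hX] at hsum ⊢
      linarith
    · simp only [hFrK]
      rw [if_neg hfT, hT f hfT, add_zero]
  have hsum := Finset.sum_le_sum fun f (_ : f ∈ Finset.univ) => hgrain f
  rw [Finset.sum_add_distrib, ← Finset.sum_filter, Finset.filter_mem_eq_inter, Finset.univ_inter] at hsum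
  exact hsum

/-! ### The wall budget for the texture's own wall data (`‖m‖ = 1` or `m = 0`) -/

/-- `√(1 − ⟪ν, m⟫²) ≤ h_{Dsc(m)}(ν)` for unit `ν` and `‖m‖ = 1 ∨ m = 0` (`Dsc 0` is the unit ball). -/
theorem sin_le_supportFn_cruxDisc' {m ν : E3} (hm : ‖m‖ = 1 ∨ m = 0) (hν : ‖ν‖ = 1) :
    Real.sqrt (1 - ⟪ν, m⟫_ℝ ^ 2) ≤ supportFn {y : E3 | ‖y‖ ≤ 1 ∧ ⟪y, m⟫_ℝ = 0} ν := by
  rcases hm with hm | hm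
  · exact sin_le_supportFn_cruxDisc hm hν
  · subst hm
    have hbdd : BddAbove ((fun y : E3 => ⟪y, ν⟫_ℝ) '' {y : E3 | ‖y‖ ≤ 1 ∧ ⟪y, (0 : E3)⟫_ℝ = 0}) := by
      refine ⟨1, ?_⟩
      rintro _ ⟨y, hy, rfl⟩
      calc ⟪y, ν⟫_ℝ ≤ ‖y‖ * ‖ν‖ := real_inner_le_norm y ν
        _ ≤ 1 * 1 := by rw [hν]; exact mul_le_mul_of_nonneg_right hy.1 zero_le_one
        _ = 1 := one_mul 1
    have hνν : ⟪ν, ν⟫_ℝ = 1 := by rw [real_inner_self_eq_norm_sq, hν, one_pow]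
    rw [inner_zero_right, zero_pow two_ne_zero, sub_zero, Real.sqrt_one]
    unfold supportFn
    calc (1 : ℝ) = ⟪ν, ν⟫_ℝ := hνν.symm
      _ ≤ sSup ((fun y : E3 => ⟪y, ν⟫_ℝ) '' {y : E3 | ‖y‖ ≤ 1 ∧ ⟪y, (0 : E3)⟫_ℝ = 0}) :=
          le_csSup hbdd ⟨ν, ⟨hν.le, inner_zero_right ν⟩, rfl⟩

/-- **Wall budget for the texture's own wall data**: for two disjoint families of cells of one complex
with antisymmetric separating normals and `‖m‖ = 1 ∨ m = 0`,
`Σ_{a ∈ sA, b ∈ sB} √(1 − ⟪ν_{ab}, m⟫²)·facetArea(Q̄_a ∩ Q̄_b) ≤ ι_{Dsc m}(⋃ sA, ⋃ sB)`. -/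
theorem sinSum_le_iota_of_polytopeCalculus' (hPC : PolytopeCalculus) {m : E3} (hm : ‖m‖ = 1 ∨ m = 0)
    {k : ℕ} (H : Fin k → Finset (E3 × ℝ)) (nv : Fin k → Fin k → E3)
    (hbd : ∀ j, Bornology.IsBounded (polytope (H j)))
    (hdisj : ∀ j j', j ≠ j' → Disjoint (polytope (H j)) (polytope (H j')))
    (hanti : ∀ i j, nv j i = -nv i j)
    (hplane : ∀ j j', j ≠ j' → ‖nv j j'‖ = 1 ∧ ∃ b : ℝ,
      closure (polytope (H j)) ∩ closure (polytope (H j')) ⊆ {x | ⟪nv j j', x⟫_ℝ = b})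
    {sA sB : Finset (Fin k)} (hAB : Disjoint sA sB) :
    ∑ a ∈ sA, ∑ b ∈ sB, Real.sqrt (1 - ⟪nv a b, m⟫_ℝ ^ 2) *
        facetArea (closure (polytope (H a)) ∩ closure (polytope (H b))) (nv a b) ≤
      (per {y : E3 | ‖y‖ ≤ 1 ∧ ⟪y, m⟫_ℝ = 0} (⋃ j ∈ sA, polytope (H j)) +
        per {y : E3 | ‖y‖ ≤ 1 ∧ ⟪y, m⟫_ℝ = 0} (⋃ j ∈ sB, polytope (H j)) -
        per {y : E3 | ‖y‖ ≤ 1 ∧ ⟪y, m⟫_ℝ = 0} (⋃ j ∈ sA ∪ sB, polytope (H j))) / 2 := by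
  set K : Set E3 := {y : E3 | ‖y‖ ≤ 1 ∧ ⟪y, m⟫_ℝ = 0} with hK
  have hKc : IsCompact K :=
    Metric.isCompact_of_isClosed_isBounded
      ((isClosed_le continuous_norm continuous_const).inter
        (isClosed_eq (continuous_id.inner continuous_const) continuous_const))
      (Metric.isBounded_closedBall.subset (cruxDisc_subset_closedBall m))
  rw [per_add_per_sub_per_union_eq_crossSum_of_polytopeCalculus hPC hKc (convex_cruxDisc m)
    (zero_mem_cruxDisc m) H nv hbd hdisj hplane hAB, le_div_iff₀ (by norm_num : (0:ℝ) < 2),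
    Finset.sum_mul]
  refine Finset.sum_le_sum fun a ha => ?_
  rw [Finset.sum_mul]
  refine Finset.sum_le_sum fun b hb => ?_
  have hab : a ≠ b := fun h => Finset.disjoint_left.1 hAB ha (h ▸ hb)
  have hν : ‖nv a b‖ = 1 := (hplane a b hab).1
  have hsymm : (supportFn K (nv b a) + supportFn K (-nv b a)) *
      facetArea (closure (polytope (H b)) ∩ closure (polytope (H a))) (nv b a) =
      (supportFn K (nv a b) + supportFn K (-nv a b)) *
      facetArea (closure (polytope (H a)) ∩ closure (polytope (H b))) (nv a b) := by
    rw [hanti a b, neg_neg, Set.inter_comm, facetArea_neg, add_comm]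
  have hval : (if a < b then (supportFn K (nv a b) + supportFn K (-nv a b)) *
        facetArea (closure (polytope (H a)) ∩ closure (polytope (H b))) (nv a b)
      else (supportFn K (nv b a) + supportFn K (-nv b a)) *
        facetArea (closure (polytope (H b)) ∩ closure (polytope (H a))) (nv b a)) =
      (supportFn K (nv a b) + supportFn K (-nv a b)) *
        facetArea (closure (polytope (H a)) ∩ closure (polytope (H b))) (nv a b) := by
    split_ifs
    · rfl
    · exact hsymm
  rw [hval]
  have hs1 : Real.sqrt (1 - ⟪nv a b, m⟫_ℝ ^ 2) ≤ supportFn K (nv a b) :=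
    sin_le_supportFn_cruxDisc' hm hν
  have hs2 : Real.sqrt (1 - ⟪nv a b, m⟫_ℝ ^ 2) ≤ supportFn K (-nv a b) := by
    have h := sin_le_supportFn_cruxDisc' (ν := -nv a b) hm (by rw [norm_neg, hν])
    rwa [inner_neg_left, neg_sq] at h
  have hfa : 0 ≤ facetArea (closure (polytope (H a)) ∩ closure (polytope (H b))) (nv a b) :=
    ENNReal.toReal_nonneg
  nlinarith [hs1, hs2, hfa]

/-! ### Discharging the gap hypothesis from the crux's pair clause `Ax m X Y` -/

/-- **Twin gap from the pair clause.**  If `Ax m X Y` (the crux's co-axiality clause for the frames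
`X, Y` about `m`) and `X` carries three admissible (bond, `⟨112⟩`) pairs about `m`, then
`h_{W(X)}(ν) ≤ h_{W(Y)}(ν) + (1/√6)·h_{Dsc m}(ν)` for every `ν`
(`W(Y)` is `W(X)` or its mirror image `R_m W(X)`). -/
theorem supportFn_cruxWulffBody_le_of_Ax {m : E3} {X Y : E3 ≃ₗᵢ[ℝ] E3}
    (hAx : ∃ (L : E3 ≃ₗᵢ[ℝ] E3) (s₁ s₂ : E3) (σ σ' : ℤ → ℤ), IsHaggSeq σ ∧ IsHaggSeq σ' ∧
      L (EuclideanSpace.single (2 : Fin 3) (1 : ℝ)) = m ∧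
      X '' fccStacking 1 (Real.sqrt (2 / 3)) ⊆
        (fun q => L q + s₁) '' barlowStacking 1 (Real.sqrt (2 / 3)) σ ∧
      Y '' fccStacking 1 (Real.sqrt (2 / 3)) ⊆
        (fun q => L q + s₂) '' barlowStacking 1 (Real.sqrt (2 / 3)) σ')
    {u w : E3} (hu : u ∈ X '' fccStacking 1 (Real.sqrt (2 / 3))) (hu1 : ‖u‖ = 1) (hum : ⟪u, m⟫_ℝ = 0)
    (hw : ‖w‖ = 1) (hwm : ⟪w, m⟫_ℝ = 0) (hwu : ⟪w, u⟫_ℝ = 0)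
    (hmir : (ℝ ∙ u)ᗮ.reflection '' (X '' fccStacking 1 (Real.sqrt (2 / 3))) =
      X '' fccStacking 1 (Real.sqrt (2 / 3)))
    {u₂ w₂ u₃ w₃ : E3} (hw₂ : w₂ = (Real.sqrt 3 / 2) • u - (1 / 2 : ℝ) • w)
    (hw₃ : w₃ = -(Real.sqrt 3 / 2) • u - (1 / 2 : ℝ) • w)
    (hu₂ : u₂ ∈ X '' fccStacking 1 (Real.sqrt (2 / 3))) (hu₂1 : ‖u₂‖ = 1) (hu₂m : ⟪u₂, m⟫_ℝ = 0)
    (hwu₂ : ⟪w₂, u₂⟫_ℝ = 0)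
    (hmir₂ : (ℝ ∙ u₂)ᗮ.reflection '' (X '' fccStacking 1 (Real.sqrt (2 / 3))) =
      X '' fccStacking 1 (Real.sqrt (2 / 3)))
    (hu₃ : u₃ ∈ X '' fccStacking 1 (Real.sqrt (2 / 3))) (hu₃1 : ‖u₃‖ = 1) (hu₃m : ⟪u₃, m⟫_ℝ = 0)
    (hwu₃ : ⟪w₃, u₃⟫_ℝ = 0)
    (hmir₃ : (ℝ ∙ u₃)ᗮ.reflection '' (X '' fccStacking 1 (Real.sqrt (2 / 3))) =
      X '' fccStacking 1 (Real.sqrt (2 / 3)))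
    (ν : E3) :
    supportFn {y : E3 | ∀ ν : E3, ⟪y, ν⟫_ℝ ≤ Real.sqrt 2 / 4 *
        ∑ᶠ w ∈ {w | w ∈ fccStacking 1 (Real.sqrt (2 / 3)) ∧ ‖w‖ = 1}, |⟪w, X.symm ν⟫_ℝ|} ν ≤
      supportFn {y : E3 | ∀ ν : E3, ⟪y, ν⟫_ℝ ≤ Real.sqrt 2 / 4 *
        ∑ᶠ w ∈ {w | w ∈ fccStacking 1 (Real.sqrt (2 / 3)) ∧ ‖w‖ = 1}, |⟪w, Y.symm ν⟫_ℝ|} ν +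
      1 / Real.sqrt 6 * supportFn {y : E3 | ‖y‖ ≤ 1 ∧ ⟪y, m⟫_ℝ = 0} ν := by
  have hself : ∃ (L : E3 ≃ₗᵢ[ℝ] E3) (s₁ s₂ : E3) (σ σ' : ℤ → ℤ), IsHaggSeq σ ∧ IsHaggSeq σ' ∧
      L (EuclideanSpace.single (2 : Fin 3) (1 : ℝ)) = m ∧
      X '' fccStacking 1 (Real.sqrt (2 / 3)) ⊆
        (fun q => L q + s₁) '' barlowStacking 1 (Real.sqrt (2 / 3)) σ ∧
      X '' fccStacking 1 (Real.sqrt (2 / 3)) ⊆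
        (fun q => L q + s₂) '' barlowStacking 1 (Real.sqrt (2 / 3)) σ' := by
    obtain ⟨L, s₁, -, σ, -, hσ, -, hLm, h1, -⟩ := hAx
    exact ⟨L, s₁, s₁, σ, σ, hσ, hσ, hLm, h1, h1⟩
  have hDc : IsCompact {y : E3 | ‖y‖ ≤ 1 ∧ ⟪y, m⟫_ℝ = 0} :=
    Metric.isCompact_of_isClosed_isBounded
      ((isClosed_le continuous_norm continuous_const).inter
        (isClosed_eq (continuous_id.inner continuous_const) continuous_const))
      (Metric.isBounded_closedBall.subset (cruxDisc_subset_closedBall m))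
  rcases cruxWulffBody_eq_or_eq_reflection_image hAx with hEq | hRm
  · rw [hEq]
    have h0 : 0 ≤ supportFn {y : E3 | ‖y‖ ≤ 1 ∧ ⟪y, m⟫_ℝ = 0} ν := by
      unfold supportFn
      exact Literature.Analysis.Convexity.sSup_inner_image_nonneg hDc (zero_mem_cruxDisc m) ν
    linarith [mul_nonneg (by positivity : (0:ℝ) ≤ 1 / Real.sqrt 6) h0]
  · rw [hRm]
    exact supportFn_le_twin_disc hself hu hu1 hum hw hwm hwu hmir hw₂ hw₃ hu₂ hu₂1 hu₂m hwu₂ hmir₂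
      hu₃ hu₃1 hu₃m hwu₃ hmir₃ ν

end Summit.Ventures.Crystal3D.Theorems

end
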